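import Mathlib
import Summits.Ventures.DiscreteObjects.Mahler.CensusAuxThresholds

/-!
# Monotonicity of the certified auxiliary-function cuts in the measure bound (venture `DiscreteObjects`, target L)

Cell `pub-namedobj`, seat `pub-namedobj-mahler-g18`. Framing: lottery ticket; floor = certified bounds/negative ranges.

A certified explicit-auxiliary-function cut `CutValidAL d k B ct` (seat g15, `CensusAuxiliaryLog`: hypothesis (H_log) on the
annulus `1 ≤ ‖z‖ ≤ B` plus `2d·m₀ + 2c·log B < N + 1`) stays valid when the bound `B` is LOWERED to any `B'` with
`1 ≤ B' ≤ B`: the annulus shrinks (`AuxBoundLog.mono`) and `c·log B' ≤ c·log B` (`c ≥ 0`).  Consequently every cut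
certificate landed for the degree-24 census at `B = 61/50` (`AuxCut24P…`, seat g17) is reusable verbatim in a census at the
Lehmer bound `B = 20/17` (`20/17 = 1.17647… > 1.17629 > M(ℓ)`), and only the cuts whose integer constant improves at the
smaller bound need new certificates.  The same monotonicity for whole tables (`CutTableValidAL`) and for the extended
thresholds (`ThresholdsValidX`, elementary entries included: `B ↦ B^k + B^{-k}` is increasing on `[1, ∞)`).
Elementary lemmas; standard axioms.
-/

namespace Summit.Ventures.DiscreteObjects.Mahler

/-- **A certified auxiliary-function cut stays valid at any smaller bound `B' ∈ [1, B]`.** -/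
theorem CutValidAL.mono {d k : ℕ} {B B' : ℝ} {ct : List ℤ × ℤ} (h : CutValidAL d k B ct) (hB' : 1 ≤ B')
    (hle : B' ≤ B) : CutValidAL d k B' ct := by
  obtain ⟨hlen, qs, m₀, c, hc0, he, hqs, hH, hconst⟩ := h
  refine ⟨hlen, qs, m₀, c, hc0, he, hqs, hH.mono hle, lt_of_le_of_lt ?_ hconst⟩
  have hlog : Real.log B' ≤ Real.log B := Real.log_le_log (by linarith) hle
  nlinarith [mul_le_mul_of_nonneg_left hlog (by linarith : (0 : ℝ) ≤ 2 * c)]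

/-- A table of certified auxiliary-function cuts stays valid at any smaller bound `B' ∈ [1, B]`. -/
theorem CutTableValidAL.mono {d : ℕ} {B B' : ℝ} {CT : List (List (List ℤ × ℤ))} (h : CutTableValidAL d B CT)
    (hB' : 1 ≤ B') (hle : B' ≤ B) : CutTableValidAL d B' CT :=
  fun k hk1 hk2 c hc => (h k hk1 hk2 c hc).mono hB' hle

/-- `B ↦ B^k + (B^k)⁻¹` is monotone on `[1, ∞)`. -/
theorem pow_add_inv_pow_mono {B B' : ℝ} (hB' : 1 ≤ B') (hle : B' ≤ B) (k : ℕ) :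
    B' ^ k + (B' ^ k)⁻¹ ≤ B ^ k + (B ^ k)⁻¹ := by
  have h1 : 1 ≤ B' ^ k := one_le_pow₀ hB'
  have h2 : B' ^ k ≤ B ^ k := pow_le_pow_left₀ (by linarith) hle k
  set x := B' ^ k with hx
  set y := B ^ k with hy
  have hx0 : 0 < x := by linarith
  have hy0 : 0 < y := by linarith
  -- `x + 1/x ≤ y + 1/y` for `1 ≤ x ≤ y`
  rw [← sub_nonneg]
  have : y + y⁻¹ - (x + x⁻¹) = (y - x) * (x * y - 1) / (x * y) := by
    field_simp
    ring
  rw [this]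
  apply div_nonneg
  · exact mul_nonneg (by linarith) (by nlinarith)
  · positivity

/-- Extended thresholds stay valid at any smaller bound `B' ∈ [1, B]`. -/
theorem ThresholdsValidX.mono {d : ℕ} {B B' : ℝ} {T : List ℕ} (h : ThresholdsValidX d B T) (hB' : 1 ≤ B')
    (hle : B' ≤ B) : ThresholdsValidX d B' T := by
  intro k hk1 hk2
  rcases h k hk1 hk2 with hel | ⟨Np, Nm, hp, hm, hcp, hcm⟩
  · left
    exact le_trans (by linarith [pow_add_inv_pow_mono hB' hle k]) hel
  · right
    exact ⟨Np, Nm, hp, hm, hcp.mono hB' hle, hcm.mono hB' hle⟩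

end Summit.Ventures.DiscreteObjects.Mahler
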